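import Literature.MathematicalPhysics.QuantumFieldTheory.Balaban1983to89.B9Ineq349L2Readings
import Literature.MathematicalPhysics.QuantumFieldTheory.Balaban1983to89.B9Ineq377L2

/-!
# `Balaban1983to89.B9Ineq368L2MLetters` — B9 p. 403 (3.68) IN BLOCK-`ℓ²`, THE SANDWICHED `C⁻¹`-LETTERS THROUGH THE LATTICE OF BLOCKS:
# `M = Q′*∘C⁻¹(U)∘Q′`, `M′ = Q′*(U′U)∘C⁻¹(U′U)∘Q′(U′U)` and their SMALL difference `M′ − M` from READINGS, with (3.57) and (3.66)–(3.67)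

T. Bałaban, *Propagators for lattice gauge theories in a background field*, Commun. Math. Phys. **99** (1985) 389–434
[`Balaban1985BackgroundPropagators`, "B9"]; [4] = T. Bałaban, *Propagators and renormalization transformations for lattice gauge theories. II*,
Commun. Math. Phys. **96** (1984) 223–250 [`Balaban1984PropagatorsII`].

statement-level skeleton of published theorems with citation tags; proofs where landed; nothing here is a claim about the Yang–Mills mass gap

THE PRINTED LOCUS (verbatim).  (3.57) p. 402: *"Q′(U′U) = Q′(U) + F′(A), … |F′(A)| ≦ O(1)α₁"*; (3.66)–(3.67) p. 403: *"(Q′G′²Q′*)(U′U) = (Q′G′²Q′*)(U) + C′(A),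
|C′(A)| ≦ O(1)α₁(Lʲη)⁴e^{−δd} … (Q′G′²Q′*)⁻¹(U′U) = (Q′G′²Q′*)⁻¹(U)(I + C′(A)(Q′G′²Q′*)⁻¹(U))⁻¹ … The inverse satisfies Theorem 3.2"*; (3.68) p. 403:
*"P(U′U) = P(U) + P′(A), |P′(A)| ≦ O(1)α₁e^{−δd}"*.

WHY THIS FILE (pub-ymgap N06 row 13, G-side `ℓ²` route, GSIDE-L2-SPEC v4 §F2b).  `B9Ineq368L2RZero.ineq368_l2_word` (g6) reduces the four (3.68) block-ℓ²
entries of `F(A) = R₀(U′U) − R₀(U)` to entries of `G′`, `G′(U′U)`, their small difference, and the block-ℓ² majorants of the sandwiched letters `M`, `M′`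
and of their SMALL difference `M′ − M` on the fine carrier.  THIS FILE supplies the latter three through the lattice of blocks 𝔅 (the frames' typing:
`Q′ : X → 𝔅`, `C⁻¹` on 𝔅, `Q′* : 𝔅 → X`), from READINGS: structured block-ℓ² Hom-readings of `Q′(V)`, `Q′*(V)` (diagonal, weights `w_c`, `w_s`,
`w_s·w_c ≦ 1`, the volume-ratio transfer of `w_c`), of the (3.57) variations `F′ = Q′(U′U) − Q′(U)`, `F′*` (diagonal, `c_F·α₁`), the (3.48) ENTRY bounds
of `C⁻¹(U)` and `C⁻¹(U′U)` on 𝔅 (Theorem 3.2 at U; at U′U = the conclusion of the Sect.-B kernel step, r06's `thm34_Cinv_uniform`), the inverse laws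
`C·C⁻¹ = 1 = C⁻¹·C` at U and U′U (`C(V) = Q′(V)G′(V)²Q′*(V)`), the block-ℓ² entries of `G′(U)`, `G′(U′U)` and of their small difference.

WHAT IS PROVED (0 sorry; 0 def; standard axioms).
* `hasL2Majorant_sandwich_rev` — the REVERSE sandwich `Q′∘L∘Q′* : 𝔅 → 𝔅` of a fine-carrier operator `L ≺₂ B v e^{−δd}`: `≺₂ (κ_cκ_sBΛ)·v·e^{−(1−α)δd}` on 𝔅
  (companion of `B6RandomWalkL2Hom.hasL2Majorant_sandwich`; same volume-ratio device, the transfer used from the output block).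
* `cinv_sub_eq` [folklore] — (3.67) as algebra: `C·C⁻¹ = 1`, `C⁻¹′·C′ = 1` (primes at U′U) ⟹ `C⁻¹′ − C⁻¹ = −C⁻¹′·(C′ − C)·C⁻¹`.
* `csq_sub_expand` [folklore] — `Q′₁G̃²Q′*₁ − Q′G²Q′* = (Q′₁ − Q′)G̃²Q′*₁ + Q′(G̃² − G²)Q′*₁ + Q′G²(Q′*₁ − Q′*)`, `G̃² − G² = (G̃ − G)G̃ + G(G̃ − G)`.
* ★ `hasL2Majorant_cDiff_sites` — `C(U′U) − C(U) ≺₂ θ_C·(Lʲη)⁴·e^{−ρd}` ON 𝔅, `θ_C` EXPLICIT and linear in the small constants (`c_Fα₁`, `θ_G`).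
* ★ `hasL2Majorant_copDiff_sites` — `C⁻¹(U′U) − C⁻¹(U) ≺₂ (Λ²c₁²B₁′θ_CB₁)·(Lʲη)⁻⁴·e^{−ρ′d}` ON 𝔅 ((3.67) in block-ℓ²).
* ★★ `hasL2Majorant_mDiff_of_readings` — `M′ − M ≺₂ θ_M·(Lʲη)⁻⁴·e^{−ρ″d}` on the fine carrier, `θ_M` EXPLICIT, from `M′ − M = Q′*₁(C⁻¹′ − C⁻¹)Q′₁ +
  F′*C⁻¹Q′₁ + Q′*C⁻¹F′` and three sandwiches (`B6RandomWalkL2Hom.hasL2Majorant_sandwich`).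

HONEST SCOPE.  Finite-dimensional bookkeeping; every letter a binder with its reading as hypothesis; nothing of [B9] asserted for Bałaban's operators;
count-neutral; NOT a node discharge; nothing continuum ∕ OS ∕ mass-gap ∕ Clay.  Cell `pub-ymgap` (HUMAN RULING D-0062), Track A node N06 [B9],
N06-ASSIGNMENT row 13, seat `pub-ymgap-dag-n06-c` (g6), 2026-08-27.
-/

noncomputable section

open scoped BigOperators

namespace Literature.MathematicalPhysics.QuantumFieldTheory.Balaban1983to89.B9Ineq368L2MLetters

open Literature.MathematicalPhysics.QuantumFieldTheory.Balaban1983to89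
open Literature.MathematicalPhysics.QuantumFieldTheory.Balaban1983to89.B6RandomWalk (Triangle254 Ineq261)
open Literature.MathematicalPhysics.QuantumFieldTheory.Balaban1983to89.B6RandomWalkL2 (l2n HasL2Majorant hasL2Majorant_mono hasL2Majorant_add)
open Literature.MathematicalPhysics.QuantumFieldTheory.Balaban1983to89.B6RandomWalkL2Hom (HasL2MajorantHom hasL2MajorantHom_iff hasL2MajorantHom_mono
  hasL2MajorantHom_add hasL2MajorantHom_comp hasL2Majorant_sites_of_entry hasL2Majorant_sandwich)
open Literature.MathematicalPhysics.QuantumFieldTheory.Balaban1983to89.B9Thm34Ext (toB6)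
open Literature.MathematicalPhysics.QuantumFieldTheory.Balaban1983to89.B9Ineq347 (ScaleTransfer)
open Literature.MathematicalPhysics.QuantumFieldTheory.Balaban1983to89.B9Ineq363L2 (hasL2Majorant_rate_mono hasL2Majorant_comp_decay)
open Literature.MathematicalPhysics.QuantumFieldTheory.Balaban1983to89.B9Ineq377L2 (hasL2Majorant_neg hasL2Majorant_sub)
open Literature.MathematicalPhysics.QuantumFieldTheory.Balaban1983to89.B9Ineq366CPrime (scaleTransfer_one)

variable {g : B9.Geometry} [Fintype g.Site] [DecidableEq g.Site] {R : ℝ} {H : Prop} {X : Type} [Fintype X]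

/-! ## §1  The reverse sandwich `Q′∘L∘Q′*` on the lattice of blocks -/

/-- **THE REVERSE SANDWICH THROUGH THE FINE CARRIER, IN BLOCK-ℓ² ON 𝔅** (the words `Q′·(…)·Q′*` of `C(V) = Q′G′²Q′*`, (3.21)/(3.66)): if `Q′ : X → 𝔅` has the
diagonal `ℓ²` Hom-majorant `κ_c·w_c(y)𝟙`, the fine-carrier operator `L` has `L ≺₂ B·v(y)·e^{−δd}`, `Q′* : 𝔅 → X` has `κ_s·w_s(y)𝟙`, `w_s·w_c ≦ 1` and
`e^{−αδd(y,y′)}w_c(y′) ≦ Λ·w_c(y)`, then ON 𝔅 (identity block map) `Q′∘L∘Q′* ≺₂ (κ_cκ_sBΛ)·v(y)·e^{−(1−α)δd}` — the factor `w_c(y)·w_s(y′)` costs one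
volume-ratio transfer from the input block `y′` to the output block `y`.
[cite: Balaban1984PropagatorsII, (2.52)–(2.55) p.232 + (2.140)–(2.141) p.247; Balaban1985BackgroundPropagators, (3.21) p.393 + (3.66) p.403 + p.398 (remark after (3.47)); derivation ours] -/
theorem hasL2Majorant_sandwich_rev (blkX : X → g.Site) (δ α Λ κc κs B : ℝ) (wc ws v : g.Site → ℝ)
    (hκc : 0 ≤ κc) (hκs : 0 ≤ κs) (hB : 0 ≤ B) (hΛ : 0 ≤ Λ) (hwc : ∀ a, 0 ≤ wc a) (hws : ∀ a, 0 ≤ ws a) (hv : ∀ a, 0 ≤ v a)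
    (hprod : ∀ a, ws a * wc a ≤ 1) (hsym : ∀ a b : g.Site, g.dist a b = g.dist b a)
    (hT : ∀ a b : g.Site, Real.exp (-(α * δ * g.dist a b)) * wc b ≤ Λ * wc a)
    {Qc : (X → ℝ) →ₗ[ℝ] (g.Site → ℝ)} {L : Module.End ℝ (X → ℝ)} {Qcs : (g.Site → ℝ) →ₗ[ℝ] (X → ℝ)}
    (hQc : HasL2MajorantHom (g := toB6 g R H) blkX (fun z : g.Site => z) Qc (fun a b : g.Site => if a = b then κc * wc a else 0))
    (hL : HasL2Majorant (g := toB6 g R H) blkX L (fun a b => B * v a * Real.exp (-(δ * g.dist a b))))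
    (hQcs : HasL2MajorantHom (g := toB6 g R H) (fun z : g.Site => z) blkX Qcs (fun a b : g.Site => if a = b then κs * ws a else 0)) :
    HasL2Majorant (g := toB6 g R H) (fun z : g.Site => z) (Qc ∘ₗ L ∘ₗ Qcs)
      (fun a b => (κc * κs * B * Λ) * v a * Real.exp (-((1 - α) * δ * g.dist a b))) := by
  letI : DecidableEq (toB6 g R H).Site := ‹DecidableEq g.Site›
  -- L ∘ Q′* : 𝔅 → X
  have hKL : ∀ a b : g.Site, 0 ≤ B * v a * Real.exp (-(δ * g.dist a b)) := fun a b => by have := hv a; positivity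
  have hLQ : HasL2MajorantHom (g := toB6 g R H) (fun z : g.Site => z) blkX (L ∘ₗ Qcs)
      (fun a b => B * v a * Real.exp (-(δ * g.dist a b)) * (κs * ws b)) := by
    have h := hasL2MajorantHom_comp (g := toB6 g R H) (fun z : g.Site => z) blkX blkX (S := (L : (X → ℝ) →ₗ[ℝ] (X → ℝ)))
      hQcs ((hasL2MajorantHom_iff (g := toB6 g R H) _ _ _).mpr hL) hKL
    refine hasL2MajorantHom_mono (g := toB6 g R H) _ _ h fun a b => le_of_eq ?_
    rw [Finset.sum_eq_single b]
    · simp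
    · intro y'' _ hne
      split_ifs with h
      · exact absurd h hne
      · rw [mul_zero]
    · intro hb; exact absurd (Finset.mem_univ b) hb
  -- Q′ ∘ (L ∘ Q′*) : 𝔅 → 𝔅
  have hK : ∀ a b : g.Site, 0 ≤ (if a = b then κc * wc a else 0) := fun a b => by
    split_ifs
    · exact mul_nonneg hκc (hwc a)
    · exact le_rfl
  have h3 := hasL2MajorantHom_comp (g := toB6 g R H) (fun z : g.Site => z) blkX (fun z : g.Site => z) hLQ hQc hK
  have h3' : HasL2Majorant (g := toB6 g R H) (fun z : g.Site => z) (Qc ∘ₗ L ∘ₗ Qcs)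
      (fun a b => (κc * wc a) * (B * v a * Real.exp (-(δ * g.dist a b)) * (κs * ws b))) := by
    refine (hasL2MajorantHom_iff (g := toB6 g R H) _ _ _).mp (hasL2MajorantHom_mono (g := toB6 g R H) _ _ h3 fun a b => le_of_eq ?_)
    rw [Finset.sum_eq_single a]
    · simp
    · intro y'' _ hne
      split_ifs with h
      · exact absurd h.symm hne
      · rw [zero_mul]
    · intro ha; exact absurd (Finset.mem_univ a) ha
  refine hasL2Majorant_mono (g := toB6 g R H) _ h3' fun a b => ?_
  -- w_c(a)·w_s(b) ≤ w_c(a)/w_c(b)-type: e^{−αδd(b,a)}·w_c(a) ≤ Λ·w_c(b), then w_s(b)·w_c(b) ≤ 1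
  have hsplit : Real.exp (-(δ * g.dist a b)) = Real.exp (-((1 - α) * δ * g.dist a b)) * Real.exp (-(α * δ * g.dist b a)) := by
    rw [← Real.exp_add, hsym b a]; congr 1; ring
  have htr := hT b a
  have hE : 0 ≤ Real.exp (-((1 - α) * δ * g.dist a b)) := Real.exp_nonneg _
  calc κc * wc a * (B * v a * Real.exp (-(δ * g.dist a b)) * (κs * ws b))
      = (κc * κs * B * v a * Real.exp (-((1 - α) * δ * g.dist a b))) * (ws b * (Real.exp (-(α * δ * g.dist b a)) * wc a)) := by
        rw [hsplit]; ring
    _ ≤ (κc * κs * B * v a * Real.exp (-((1 - α) * δ * g.dist a b))) * (ws b * (Λ * wc b)) := by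
        refine mul_le_mul_of_nonneg_left (mul_le_mul_of_nonneg_left htr (hws b)) ?_
        have := hv a; positivity
    _ = (κc * κs * B * Λ) * v a * Real.exp (-((1 - α) * δ * g.dist a b)) * (ws b * wc b) := by ring
    _ ≤ (κc * κs * B * Λ) * v a * Real.exp (-((1 - α) * δ * g.dist a b)) * 1 := by
        refine mul_le_mul_of_nonneg_left (hprod b) ?_
        have := hv a; positivity
    _ = (κc * κs * B * Λ) * v a * Real.exp (-((1 - α) * δ * g.dist a b)) := by ring

/-! ## §2  (3.66)–(3.67): the algebra and `C(U′U) − C(U)`, `C⁻¹(U′U) − C⁻¹(U)` on 𝔅 in block-ℓ² -/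

/-- **(3.67), the algebra** [folklore]: if `C·C⁻¹ = 1` at U and `C⁻¹₁·C₁ = 1` at U′U, then `C⁻¹₁ − C⁻¹ = −C⁻¹₁·(C₁ − C)·C⁻¹` (the resolvent form of
«(Q′G′²Q′*)⁻¹(U′U) = (Q′G′²Q′*)⁻¹(U)(I + C′(A)(Q′G′²Q′*)⁻¹(U))⁻¹»). [cite: Balaban1985BackgroundPropagators, (3.66)–(3.67) p.403] -/
theorem cinv_sub_eq {A : Type*} [Ring A] {C C₁ Ci Ci₁ : A} (h : C * Ci = 1) (h₁ : Ci₁ * C₁ = 1) :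
    Ci₁ - Ci = -(Ci₁ * (C₁ - C) * Ci) := by
  have e : Ci₁ * (C₁ - C) * Ci = Ci - Ci₁ := by
    rw [mul_sub, sub_mul, mul_assoc Ci₁ C Ci, h, mul_one, h₁, one_mul]
  rw [e, neg_sub]

/-- `(G̃ − G)G̃ + G(G̃ − G) = G̃² − G²` in any ring. [folklore] [cite: Balaban1985BackgroundPropagators, (3.65)–(3.66) p.403] -/
theorem sq_sub_sq_expand {A : Type*} [Ring A] (G Gt : A) : (Gt - G) * Gt + G * (Gt - G) = Gt * Gt - G * G := by
  noncomm_ring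

omit [Fintype X] in
/-- **`C(U′U) − C(U)` expanded into words with ONE small letter each** [folklore]: with `Q′₁ = Q′(U′U)`, `Q′*₁`, `G̃ = G′(U′U)`, `G = G′(U)`:
`Q′₁G̃G̃Q′*₁ − Q′GGQ′* = (Q′₁ − Q′)G̃G̃Q′*₁ + Q′((G̃ − G)G̃ + G(G̃ − G))Q′*₁ + Q′GG(Q′*₁ − Q′*)`.
[cite: Balaban1985BackgroundPropagators, (3.65)–(3.66) p.403] -/
theorem csq_sub_expand {Y Z : Type} [Fintype Y] [Fintype Z]
    (Qc Qc₁ : (X → ℝ) →ₗ[ℝ] (Y → ℝ)) (Qcs Qcs₁ : (Z → ℝ) →ₗ[ℝ] (X → ℝ)) (G Gt : Module.End ℝ (X → ℝ)) :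
    Qc₁ ∘ₗ (Gt * Gt) ∘ₗ Qcs₁ - Qc ∘ₗ (G * G) ∘ₗ Qcs
      = (Qc₁ - Qc) ∘ₗ (Gt * Gt) ∘ₗ Qcs₁ + Qc ∘ₗ ((Gt - G) * Gt + G * (Gt - G)) ∘ₗ Qcs₁ + Qc ∘ₗ (G * G) ∘ₗ (Qcs₁ - Qcs) := by
  rw [sq_sub_sq_expand]
  simp only [LinearMap.sub_comp, LinearMap.comp_sub]
  abel

variable (blkX : X → g.Site) (d : ℕ)

/-- ★ **`C′(A) = C(U′U) − C(U)` IN BLOCK-ℓ² ON 𝔅** («|C′(A)| ≦ O(1)α₁(Lʲη)⁴e^{−δd}», (3.66)): from the structured Hom-readings of `Q′`, `Q′*` at U′U and of the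
(3.57) variations `F′ = Q′(U′U) − Q′(U)`, `F′* = Q′*(U′U) − Q′*(U)` (diagonal, constants `θ_c`, `θ_s` — print: `c_Fα₁`), the weights' laws, the block-ℓ²
entries `G, G̃ ≺₂ B_G(Lʲη)²e^{−δd}` and the SMALL `G̃ − G ≺₂ θ_G(Lʲη)²e^{−δd}` (print: (3.65), `O(α₁)`), the transfer of `(Lʲη)²` and (2.61):
`C(U′U) − C(U) ≺₂ κ_cκ_sΛ_C·Λc₁·B_G·(θ_cB_G·κ_s/κ_s… ) …` — precisely `(Λ_C·Λ·c₁(β)·B_G·(θ_c·κ_s·B_G + κ_c·κ_s·2θ_G + κ_c·θ_s·B_G))·(Lʲη)⁴·e^{−(1−α_C)ρd}`,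
by `csq_sub_expand`, `hasL2Majorant_comp_decay` for the squares and three reverse sandwiches.
[cite: Balaban1985BackgroundPropagators, (3.66) p.403 + (3.57) p.402 + (3.65) p.403 + (3.21) p.393; Balaban1984PropagatorsII, Lemma 2.1 p.234 + (2.52)–(2.55) p.232 + Prop. 2.6 (2.140)–(2.141) p.247] -/
theorem hasL2Majorant_cDiff_sites (δ₀ δ α β ρ Λ αC ΛC κc κs θc θs BG θG : ℝ) (wc ws : g.Site → ℝ)
    (hκc : 0 ≤ κc) (hκs : 0 ≤ κs) (hθc : 0 ≤ θc) (hθs : 0 ≤ θs) (hBG : 0 ≤ BG) (hθG : 0 ≤ θG) (hΛ : 0 ≤ Λ) (hΛC : 0 ≤ ΛC)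
    (hρ : 0 ≤ ρ) (hα : 0 ≤ α) (hβ : 0 ≤ β) (hδ₀ : 0 ≤ δ₀) (hr : ρ + (α + β) * δ₀ ≤ δ)
    (hwc : ∀ a, 0 ≤ wc a) (hws : ∀ a, 0 ≤ ws a) (hprod : ∀ a, ws a * wc a ≤ 1)
    (hdnn : ∀ a b : g.Site, 0 ≤ g.dist a b) (hsym : ∀ a b : g.Site, g.dist a b = g.dist b a) (htri : Triangle254 (toB6 g R H))
    (h261 : Ineq261 d (toB6 g R H) δ₀ β) (hT2 : ScaleTransfer g δ₀ α Λ (fun a => g.len a ^ 2))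
    (hTC : ∀ a b : g.Site, Real.exp (-(αC * ρ * g.dist a b)) * wc b ≤ ΛC * wc a)
    {Qc Qc₁ : (X → ℝ) →ₗ[ℝ] (g.Site → ℝ)} {Qcs Qcs₁ : (g.Site → ℝ) →ₗ[ℝ] (X → ℝ)} {G Gt : Module.End ℝ (X → ℝ)}
    (hQc : HasL2MajorantHom (g := toB6 g R H) blkX (fun z : g.Site => z) Qc (fun a b : g.Site => if a = b then κc * wc a else 0))
    (hQcs₁ : HasL2MajorantHom (g := toB6 g R H) (fun z : g.Site => z) blkX Qcs₁ (fun a b : g.Site => if a = b then κs * ws a else 0))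
    (hFc : HasL2MajorantHom (g := toB6 g R H) blkX (fun z : g.Site => z) (Qc₁ - Qc) (fun a b : g.Site => if a = b then θc * wc a else 0))
    (hFcs : HasL2MajorantHom (g := toB6 g R H) (fun z : g.Site => z) blkX (Qcs₁ - Qcs) (fun a b : g.Site => if a = b then θs * ws a else 0))
    (hG : HasL2Majorant (g := toB6 g R H) blkX G (fun a b => BG * g.len a ^ 2 * Real.exp (-(δ * g.dist a b))))
    (hGt : HasL2Majorant (g := toB6 g R H) blkX Gt (fun a b => BG * g.len a ^ 2 * Real.exp (-(δ * g.dist a b))))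
    (hdG : HasL2Majorant (g := toB6 g R H) blkX (Gt - G) (fun a b => θG * g.len a ^ 2 * Real.exp (-(δ * g.dist a b)))) :
    HasL2Majorant (g := toB6 g R H) (fun z : g.Site => z) (Qc₁ ∘ₗ (Gt * Gt) ∘ₗ Qcs₁ - Qc ∘ₗ (G * G) ∘ₗ Qcs)
      (fun a b => (ΛC * (Λ * B6.c1 d δ₀ β) * (θc * κs * (BG * BG) + κc * κs * (θG * BG + BG * θG) + κc * θs * (BG * BG))) *
        g.len a ^ 4 * Real.exp (-((1 - αC) * ρ * g.dist a b))) := by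
  letI : DecidableEq (toB6 g R H).Site := ‹DecidableEq g.Site›
  have hw2 : ∀ a : g.Site, 0 ≤ g.len a ^ 2 := fun a => sq_nonneg _
  have hw4 : ∀ a : g.Site, 0 ≤ g.len a ^ 4 := fun a => by positivity
  have hc : 0 ≤ B6.c1 d δ₀ β := B6RandomWalk.c1_nonneg _ _ _
  have hρδ : ρ ≤ δ := by nlinarith
  -- the squares on the fine carrier: weights (Lʲη)²·(Lʲη)² = (Lʲη)⁴ after one transfer
  have sq := fun (A₁ A₂ : ℝ) (hA₁ : 0 ≤ A₁) (hA₂ : 0 ≤ A₂) {T₁ T₂ : Module.End ℝ (X → ℝ)}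
      (h₁ : HasL2Majorant (g := toB6 g R H) blkX T₁ (fun a b => A₁ * g.len a ^ 2 * Real.exp (-(δ * g.dist a b))))
      (h₂ : HasL2Majorant (g := toB6 g R H) blkX T₂ (fun a b => A₂ * g.len a ^ 2 * Real.exp (-(δ * g.dist a b)))) =>
    hasL2Majorant_comp_decay (R := R) (H := H) blkX d δ₀ α β ρ δ Λ A₁ A₂ (fun a => g.len a ^ 2) (fun a => g.len a ^ 2) hw2 hw2 hΛ hA₁
      hA₂ hρ hr hdnn htri hT2 h261 h₁ (hasL2Majorant_rate_mono (R := R) (H := H) blkX A₂ (fun a => g.len a ^ 2) hA₂ hw2 hρδ hdnn h₂)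
  have hGtGt := sq BG BG hBG hBG hGt hGt
  have hGG := sq BG BG hBG hBG hG hG
  have hmid : HasL2Majorant (g := toB6 g R H) blkX ((Gt - G) * Gt + G * (Gt - G))
      (fun a b => (Λ * B6.c1 d δ₀ β * (θG * BG + BG * θG)) * g.len a ^ 4 * Real.exp (-(ρ * g.dist a b))) := by
    refine hasL2Majorant_mono (g := toB6 g R H) _ (hasL2Majorant_add (g := toB6 g R H) _ (sq θG BG hθG hBG hdG hGt) (sq BG θG hBG hθG hG hdG))
      fun a b => le_of_eq ?_
    ring
  have hGtGt' : HasL2Majorant (g := toB6 g R H) blkX (Gt * Gt)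
      (fun a b => (Λ * B6.c1 d δ₀ β * (BG * BG)) * g.len a ^ 4 * Real.exp (-(ρ * g.dist a b))) :=
    hasL2Majorant_mono (g := toB6 g R H) _ hGtGt fun a b => le_of_eq (by ring)
  have hGG' : HasL2Majorant (g := toB6 g R H) blkX (G * G)
      (fun a b => (Λ * B6.c1 d δ₀ β * (BG * BG)) * g.len a ^ 4 * Real.exp (-(ρ * g.dist a b))) :=
    hasL2Majorant_mono (g := toB6 g R H) _ hGG fun a b => le_of_eq (by ring)
  -- the three reverse sandwiches on 𝔅
  have s1 := hasL2Majorant_sandwich_rev (R := R) (H := H) blkX ρ αC ΛC θc κs (Λ * B6.c1 d δ₀ β * (BG * BG)) wc ws (fun a => g.len a ^ 4)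
    hθc hκs (by positivity) hΛC hwc hws hw4 hprod hsym hTC hFc hGtGt' hQcs₁
  have s2 := hasL2Majorant_sandwich_rev (R := R) (H := H) blkX ρ αC ΛC κc κs (Λ * B6.c1 d δ₀ β * (θG * BG + BG * θG)) wc ws
    (fun a => g.len a ^ 4) hκc hκs (by positivity) hΛC hwc hws hw4 hprod hsym hTC hQc hmid hQcs₁
  have s3 := hasL2Majorant_sandwich_rev (R := R) (H := H) blkX ρ αC ΛC κc θs (Λ * B6.c1 d δ₀ β * (BG * BG)) wc ws (fun a => g.len a ^ 4)
    hκc hθs (by positivity) hΛC hwc hws hw4 hprod hsym hTC hQc hGG' hFcs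
  rw [csq_sub_expand]
  refine hasL2Majorant_mono (g := toB6 g R H) _
    (hasL2Majorant_add (g := toB6 g R H) _ (hasL2Majorant_add (g := toB6 g R H) _ s1 s2) s3) fun a b => le_of_eq ?_
  ring

/-- ★ **(3.67) IN BLOCK-ℓ² ON 𝔅: `C⁻¹(U′U) − C⁻¹(U) ≺₂ (Λc₁)²·B₁′·θ_C·B₁·(Lʲη)⁻⁴·e^{−ρ′d}`** from the ENTRY bounds of `C⁻¹(U)` (Theorem 3.2 (3.48) at U,
`B₁`) and of `C⁻¹(U′U)` (the kernel step's output at U′U, `B₁′`) on 𝔅, the block-ℓ² bound `C(U′U) − C(U) ≺₂ θ_C(Lʲη)⁴e^{−δd}` (e.g. `hasL2Majorant_cDiff_sites`),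
the inverse laws `C(U)C⁻¹(U) = 1`, `C⁻¹(U′U)C(U′U) = 1` (`cinv_sub_eq`), the transfer of `(Lʲη)⁻⁴` and (2.61) (two compositions; the second transfer is free).
[cite: Balaban1985BackgroundPropagators, (3.66)–(3.67) p.403 + Thm 3.2 (3.48) p.398; Balaban1984PropagatorsII, Lemma 2.1 p.234 + (2.52)–(2.55) p.232 + Prop. 2.6 (2.140)–(2.141) p.247] -/
theorem hasL2Majorant_copDiff_sites (δ₀ δ α β ρ ρ' Λ B₁ B₁' θC : ℝ)
    (hB₁ : 0 ≤ B₁) (hB₁' : 0 ≤ B₁') (hθC : 0 ≤ θC) (hΛ : 0 ≤ Λ) (hρ : 0 ≤ ρ) (hρ' : 0 ≤ ρ') (hα : 0 ≤ α) (hβ : 0 ≤ β) (hδ₀ : 0 ≤ δ₀)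
    (hr : ρ + (α + β) * δ₀ ≤ δ) (hr' : ρ' + (α + β) * δ₀ ≤ ρ)
    (hdnn : ∀ a b : g.Site, 0 ≤ g.dist a b) (htri : Triangle254 (toB6 g R H)) (hlen : ∀ y : g.Site, 0 < g.len y)
    (h261 : Ineq261 d (toB6 g R H) δ₀ β) (hT4 : ScaleTransfer g δ₀ α Λ (fun a => (g.len a ^ 4)⁻¹))
    {C C₁ Cop Cop₁ : Module.End ℝ (g.Site → ℝ)} (hinv : C * Cop = 1) (hinv₁ : Cop₁ * C₁ = 1)
    (h348 : ∀ y y' : g.Site, |Cop (Pi.single y' 1) y| ≤ B₁ * (g.len y ^ 4)⁻¹ * Real.exp (-(δ * g.dist y y')))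
    (h348' : ∀ y y' : g.Site, |Cop₁ (Pi.single y' 1) y| ≤ B₁' * (g.len y ^ 4)⁻¹ * Real.exp (-(δ * g.dist y y')))
    (hC : HasL2Majorant (g := toB6 g R H) (fun z : g.Site => z) (C₁ - C) (fun a b => θC * g.len a ^ 4 * Real.exp (-(δ * g.dist a b)))) :
    HasL2Majorant (g := toB6 g R H) (fun z : g.Site => z) (Cop₁ - Cop)
      (fun a b => (1 * B6.c1 d δ₀ β * B₁' * (Λ * B6.c1 d δ₀ β * θC * B₁)) * (g.len a ^ 4)⁻¹ * Real.exp (-(ρ' * g.dist a b))) := by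
  letI : DecidableEq (toB6 g R H).Site := ‹DecidableEq g.Site›
  have hw4 : ∀ a : g.Site, 0 ≤ g.len a ^ 4 := fun a => by positivity
  have hw4i : ∀ a : g.Site, 0 ≤ (g.len a ^ 4)⁻¹ := fun a => inv_nonneg.mpr (hw4 a)
  have hw0 : ∀ _a : g.Site, 0 ≤ (1 : ℝ) := fun _ => zero_le_one
  have hc : 0 ≤ B6.c1 d δ₀ β := B6RandomWalk.c1_nonneg _ _ _
  -- entry bounds ⟹ block-ℓ² on 𝔅
  have hL : HasL2Majorant (g := toB6 g R H) (fun z : g.Site => z) Cop (fun a b => B₁ * (g.len a ^ 4)⁻¹ * Real.exp (-(δ * g.dist a b))) :=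
    hasL2Majorant_sites_of_entry (g := toB6 g R H) h348
  have hL₁ : HasL2Majorant (g := toB6 g R H) (fun z : g.Site => z) Cop₁ (fun a b => B₁' * (g.len a ^ 4)⁻¹ * Real.exp (-(δ * g.dist a b))) :=
    hasL2Majorant_sites_of_entry (g := toB6 g R H) h348'
  have hρδ : ρ ≤ δ := by nlinarith
  -- (C₁ − C)·Cop: weights (Lʲη)⁴·(Lʲη)⁻⁴ = 1 after the transfer of (Lʲη)⁻⁴
  have w1 := hasL2Majorant_comp_decay (R := R) (H := H) (fun z : g.Site => z) d δ₀ α β ρ δ Λ θC B₁ (fun a => g.len a ^ 4)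
    (fun a => (g.len a ^ 4)⁻¹) hw4 hw4i hΛ hθC hB₁ hρ hr hdnn htri hT4 h261 hC (hasL2Majorant_rate_mono (R := R) (H := H) _ B₁ _ hB₁ hw4i hρδ hdnn hL)
  have w1' : HasL2Majorant (g := toB6 g R H) (fun z : g.Site => z) ((C₁ - C) * Cop)
      (fun a b => (Λ * B6.c1 d δ₀ β * θC * B₁) * (1 : ℝ) * Real.exp (-(ρ * g.dist a b))) := by
    refine hasL2Majorant_mono (g := toB6 g R H) _ w1 fun a b => le_of_eq ?_
    have ha : g.len a ^ 4 ≠ 0 := pow_ne_zero 4 (hlen a).ne'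
    rw [mul_inv_cancel₀ ha]; ring
  have hρ'ρ : ρ' ≤ ρ := by nlinarith
  have w1'' := hasL2Majorant_rate_mono (R := R) (H := H) (fun z : g.Site => z) (Λ * B6.c1 d δ₀ β * θC * B₁) (fun _ => (1 : ℝ))
    (by positivity) hw0 hρ'ρ hdnn w1'
  -- Cop₁·((C₁ − C)·Cop): the transfer of the constant weight is free
  have hT1 : ScaleTransfer g δ₀ α 1 (fun _ => (1 : ℝ)) := scaleTransfer_one (mul_nonneg hα hδ₀) hdnn
  have w2 := hasL2Majorant_comp_decay (R := R) (H := H) (fun z : g.Site => z) d δ₀ α β ρ' ρ 1 B₁' (Λ * B6.c1 d δ₀ β * θC * B₁)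
    (fun a => (g.len a ^ 4)⁻¹) (fun _ => (1 : ℝ)) hw4i hw0 zero_le_one hB₁' (by positivity) hρ' hr' hdnn htri hT1 h261
    (hasL2Majorant_rate_mono (R := R) (H := H) _ B₁' _ hB₁' hw4i hρδ hdnn hL₁) w1''
  rw [cinv_sub_eq hinv hinv₁]
  refine hasL2Majorant_mono (g := toB6 g R H) _ (hasL2Majorant_neg (R := R) (H := H) _ ?_) fun a b => le_rfl
  have e : Cop₁ * (C₁ - C) * Cop = Cop₁ * ((C₁ - C) * Cop) := mul_assoc _ _ _
  rw [e]
  exact hasL2Majorant_mono (g := toB6 g R H) _ w2 fun a b => le_of_eq (by ring)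

/-! ## §3  The sandwiched letters `M`, `M′` and their small difference on the fine carrier -/

omit [Fintype X] in
/-- **`M′ − M` expanded** [folklore]: `Q′*₁C⁻¹₁Q′₁ − Q′*C⁻¹Q′ = Q′*₁(C⁻¹₁ − C⁻¹)Q′₁ + (Q′*₁ − Q′*)C⁻¹Q′₁ + Q′*C⁻¹(Q′₁ − Q′)`.
[cite: Balaban1985BackgroundPropagators, (3.57) p.402 + (3.67)–(3.68) p.403] -/
theorem m_sub_expand {Y : Type} [Fintype Y] (Qc Qc₁ : (X → ℝ) →ₗ[ℝ] (Y → ℝ)) (Qcs Qcs₁ : (Y → ℝ) →ₗ[ℝ] (X → ℝ))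
    (Cop Cop₁ : Module.End ℝ (Y → ℝ)) :
    Qcs₁ ∘ₗ Cop₁ ∘ₗ Qc₁ - Qcs ∘ₗ Cop ∘ₗ Qc
      = Qcs₁ ∘ₗ (Cop₁ - Cop) ∘ₗ Qc₁ + (Qcs₁ - Qcs) ∘ₗ Cop ∘ₗ Qc₁ + Qcs ∘ₗ Cop ∘ₗ (Qc₁ - Qc) := by
  simp only [LinearMap.sub_comp, LinearMap.comp_sub]
  abel

/-- ★★ **`M′ − M = Q′*(U′U)C⁻¹(U′U)Q′(U′U) − Q′*(U)C⁻¹(U)Q′(U)` IN BLOCK-ℓ² ON THE FINE CARRIER, FROM READINGS** — the SMALL sandwiched letter of (3.68):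
from the structured Hom-readings of `Q′, Q′*` at U and U′U, of `F′ = Q′(U′U) − Q′(U)`, `F′* ` (constants `θ_c`, `θ_s`, print `c_Fα₁`), the weights' laws and
the transfer of `w_c` at `(ρ′, α_C)`, the ENTRY bound of `C⁻¹(U)` on 𝔅 and a block-ℓ² bound `C⁻¹(U′U) − C⁻¹(U) ≺₂ θ_I(Lʲη)⁻⁴e^{−ρ′d}` on 𝔅 (e.g.
`hasL2Majorant_copDiff_sites`): `M′ − M ≺₂ Λ_C·(κ_s²… )` — precisely `(Λ_C·(κ_sκ_cθ_I + θ_sκ_cB₁ + κ_sθ_cB₁))·(Lʲη)⁻⁴·e^{−(1−α_C)ρ′d}`, by `m_sub_expand`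
and three sandwiches `B6RandomWalkL2Hom.hasL2Majorant_sandwich`.
[cite: Balaban1985BackgroundPropagators, (3.57) p.402 + (3.66)–(3.68) p.403 + (3.25) p.394; Balaban1984PropagatorsII, (2.52)–(2.55) p.232 + Prop. 2.6 (2.140)–(2.141) p.247] -/
theorem hasL2Majorant_mDiff_of_readings (ρ' δ αC ΛC κc κs θc θs B₁ θI : ℝ) (wc ws : g.Site → ℝ)
    (hκc : 0 ≤ κc) (hκs : 0 ≤ κs) (hθc : 0 ≤ θc) (hθs : 0 ≤ θs) (hB₁ : 0 ≤ B₁) (hθI : 0 ≤ θI) (hΛC : 0 ≤ ΛC) (hρ'δ : ρ' ≤ δ)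
    (hws : ∀ a, 0 ≤ ws a) (hprod : ∀ a, ws a * wc a ≤ 1) (hdnn : ∀ a b : g.Site, 0 ≤ g.dist a b)
    (hTC : ∀ a b : g.Site, Real.exp (-(αC * ρ' * g.dist a b)) * wc b ≤ ΛC * wc a)
    {Qc Qc₁ : (X → ℝ) →ₗ[ℝ] (g.Site → ℝ)} {Qcs Qcs₁ : (g.Site → ℝ) →ₗ[ℝ] (X → ℝ)} {Cop Cop₁ : Module.End ℝ (g.Site → ℝ)}
    (hQc₁ : HasL2MajorantHom (g := toB6 g R H) blkX (fun z : g.Site => z) Qc₁ (fun a b : g.Site => if a = b then κc * wc a else 0))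
    (hQcs : HasL2MajorantHom (g := toB6 g R H) (fun z : g.Site => z) blkX Qcs (fun a b : g.Site => if a = b then κs * ws a else 0))
    (hQcs₁ : HasL2MajorantHom (g := toB6 g R H) (fun z : g.Site => z) blkX Qcs₁ (fun a b : g.Site => if a = b then κs * ws a else 0))
    (hFc : HasL2MajorantHom (g := toB6 g R H) blkX (fun z : g.Site => z) (Qc₁ - Qc) (fun a b : g.Site => if a = b then θc * wc a else 0))
    (hFcs : HasL2MajorantHom (g := toB6 g R H) (fun z : g.Site => z) blkX (Qcs₁ - Qcs) (fun a b : g.Site => if a = b then θs * ws a else 0))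
    (h348 : ∀ y y' : g.Site, |Cop (Pi.single y' 1) y| ≤ B₁ * (g.len y ^ 4)⁻¹ * Real.exp (-(δ * g.dist y y')))
    (hI : HasL2Majorant (g := toB6 g R H) (fun z : g.Site => z) (Cop₁ - Cop)
      (fun a b => θI * (g.len a ^ 4)⁻¹ * Real.exp (-(ρ' * g.dist a b)))) :
    HasL2Majorant (g := toB6 g R H) blkX (Qcs₁ ∘ₗ Cop₁ ∘ₗ Qc₁ - Qcs ∘ₗ Cop ∘ₗ Qc)
      (fun a b => (ΛC * (κs * κc * θI + θs * κc * B₁ + κs * θc * B₁)) * (g.len a ^ 4)⁻¹ *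
        Real.exp (-((1 - αC) * ρ' * g.dist a b))) := by
  letI : DecidableEq (toB6 g R H).Site := ‹DecidableEq g.Site›
  have hw4i : ∀ a : g.Site, 0 ≤ (g.len a ^ 4)⁻¹ := fun a => inv_nonneg.mpr (by positivity)
  have hL : HasL2Majorant (g := toB6 g R H) (fun z : g.Site => z) Cop (fun a b => B₁ * (g.len a ^ 4)⁻¹ * Real.exp (-(ρ' * g.dist a b))) :=
    hasL2Majorant_rate_mono (R := R) (H := H) _ B₁ (fun a => (g.len a ^ 4)⁻¹) hB₁ hw4i hρ'δ hdnn
      (hasL2Majorant_sites_of_entry (g := toB6 g R H) h348)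
  have s1 := hasL2Majorant_sandwich (g := toB6 g R H) blkX ρ' αC ΛC κc κs θI wc ws (fun a => (g.len a ^ 4)⁻¹) hκc hκs hθI hΛC hws hw4i
    hprod hTC hQc₁ hI hQcs₁
  have s2 := hasL2Majorant_sandwich (g := toB6 g R H) blkX ρ' αC ΛC κc θs B₁ wc ws (fun a => (g.len a ^ 4)⁻¹) hκc hθs hB₁ hΛC hws hw4i
    hprod hTC hQc₁ hL hFcs
  have s3 := hasL2Majorant_sandwich (g := toB6 g R H) blkX ρ' αC ΛC θc κs B₁ wc ws (fun a => (g.len a ^ 4)⁻¹) hθc hκs hB₁ hΛC hws hw4i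
    hprod hTC hFc hL hQcs
  have s1' : HasL2Majorant (g := toB6 g R H) blkX (Qcs₁ ∘ₗ (Cop₁ - Cop) ∘ₗ Qc₁)
      (fun a b => κs * κc * θI * ΛC * (g.len a ^ 4)⁻¹ * Real.exp (-((1 - αC) * ρ' * g.dist a b))) := s1
  have s2' : HasL2Majorant (g := toB6 g R H) blkX ((Qcs₁ - Qcs) ∘ₗ Cop ∘ₗ Qc₁)
      (fun a b => θs * κc * B₁ * ΛC * (g.len a ^ 4)⁻¹ * Real.exp (-((1 - αC) * ρ' * g.dist a b))) := s2
  have s3' : HasL2Majorant (g := toB6 g R H) blkX (Qcs ∘ₗ Cop ∘ₗ (Qc₁ - Qc))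
      (fun a b => κs * θc * B₁ * ΛC * (g.len a ^ 4)⁻¹ * Real.exp (-((1 - αC) * ρ' * g.dist a b))) := s3
  rw [m_sub_expand]
  refine hasL2Majorant_mono (g := toB6 g R H) _
    (hasL2Majorant_add (g := toB6 g R H) _ (hasL2Majorant_add (g := toB6 g R H) _ s1' s2') s3') fun a b => le_of_eq ?_
  ring

end Literature.MathematicalPhysics.QuantumFieldTheory.Balaban1983to89.B9Ineq368L2MLetters
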